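import Summits.QuantumFields.BalabanUV.Beta.GAN24.Push4Slices
import Summits.QuantumFields.BalabanUV.Beta.GAN24.LatticeFreeze

/-!
# `BalabanUV.Beta.GAN24.Push4FrozenLayers` — binder row G-an2-4 / (CONV-C), W-slot road «W3», ROW W3-F3b (T-irr) (gan24-p1-g5 `SKELETON-W3.md` v1.0.2
# §8.6 (F3-core-b); journal INTENT «W3-TIRR*» l.7944), core part 4a: THE LAYERS OF THE SLICE PUSH AND THE FIRST FREEZING STEP (the right kernel leg) —
# `push₃ l r (X κ u) ν y′ x′ z′ (inl α) (inl β) = Σ_{κ₂ κ₁ κ′} r β z′ κ₂ u · l α x′ κ₁ u · r ν y′ κ′ u · sliceSum X κ u κ′ κ₁ κ₂ + REMAINDER`,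
# `|REMAINDER| ≤ (d+1)³ · C · M₁ · Σ (one q, two p, two Zl)` — ONE TAYLOR ORDER, the first-moment half of (T-irr)

NOT IN PRINT; OUR PROOF ATTEMPT ([folklore] real analysis over leaf-17's `Push4` carrier; 0 cited facts, 0 `def`, 0 `def … : Prop`, 0 wall binders).  HONEST
FRAMING (cell contract, verbatim): «discharging `BetaPertH` makes Bałaban's UV stability UNCONDITIONAL — a real constructive-QFT result; it is NOT the
continuum limit and NOT the Clay problem.»  HONEST DEPENDENCY (verbatim): «continuum YM on T⁴ ⇐ BetaPertH ∧ nine spine estimates (0/9 proved); BetaPertH ⇐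
(D1) ∧ (D4) ∧ CAP+tail; G-an2-4 gates asym, D1 and NE2/3/4.»  Discharges NOTHING of «T2Shape» ∕ «T2SupRate» ∕ (hW₂, hW₂all); NOT «W-slot closed», NEVER
«G-an2-4 closed»; NOT `BetaPertH`, NOT continuum, NOT Clay.

## Setting (one slice `X κ u` of a `LocStencil₂ X C δ` table; the output data `ν y′ x′ z′ α β` fixed)
The three inner legs of `Push4Slices.push₃` — the second table leg `v ↦ r ν y′ κ′ v`, the left kernel leg `x ↦ l α x′ κ₁ x`, the right kernel leg
`z ↦ r β z′ κ₂ z` — are given with a SUP allowance and a LIPSCHITZ allowance RELATIVE TO THE BASE POINT `u` (the shape `LatticeFreeze` consumes; the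
(N1)∕(N1′)-type envelopes of `RespStepDecay` produce it by `EnvelopeBlockSum.env_wobble` + `LatticeFreeze.abs_sub_le_of_unit_steps`, in part 5):
`|leg v| ≤ p·e^{κ₀|v−u|₁}`, `|leg v − leg u| ≤ q·|v−u|₁·e^{κ₀|v−u|₁}`, `0 ≤ κ₀ < δ`.

## What is proved (generic `d`)
* §0 summation helpers (`summable_of_abs_le_exp`, `abs_tsum_le_of_abs_le_exp`, `abs_sub_le_of_three`, `abs_base_le`).
* §1 the layers of the slice push and their sizes: `abs_slice_le`, `abs_tsum_slice_le`, `abs_inner_le` (`|Σ'_{u′} r·X| ≤ p₁·C·Zl₁·e^{−δ(|x−u|₁+|z−u|₁)}`,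
  `Zl₁ := Zl(δ−κ₀)`), `abs_W_le` (`W := vertexW r (X κ u) ν y′`, `≤ (d+1)·p₁·C·Zl₁·e^{…}`), `abs_xlayer_le`, `abs_G_le` (`G := Σ'_x Σ_{κ₁} l·W`,
  `≤ (d+1)²·p₁p₂·C·Zl₁²·e^{−δ|z−u|₁}`), with the summability of every layer and the finite-sum interchange.
* §2 THE FIRST FREEZING STEP `push₃ = T₁ + R_C` (**`stepC`**, the right kernel leg, outermost layer): `|R_C| ≤ (d+1)³·q₃·p₁p₂·C·Zl₁²·M₁`,
  `M₁ := (2/(δ−κ₀))·Zl((δ−κ₀)/2)` (`LatticeFreeze.abs_tsum_mul_sub_frozen_le`).  Steps B, A and the packaging are part 4b `GAN24/Push4Frozen`.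
Unit `b2b-balaban-gan24-formalise-leaf-12` (G-an2-4 formalisation swarm, leaf prover 12, gen 20; ROW W3-F3b holder), 2026-08-20.
-/

noncomputable section

open Finset
open scoped BigOperators
open Literature.MathematicalPhysics.QuantumFieldTheory
open Literature.MathematicalPhysics.QuantumFieldTheory.Balaban1983to89
open Literature.MathematicalPhysics.QuantumFieldTheory.Balaban1983to89.Beta
open B12Sec2to5 (l1 l1_nonneg)
open ExpKernelCalculus (MKer comp Zl Zl_nonneg Zl_pos summable_exp_shift summable_exp_shift' tsum_exp_shift tsum_exp_shift' l1_sub_triangle l1_sub_symm)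
open OneStepResolventKernel (Fib)
open BalabanCompositeJets (LocStencil₂ LocStencil₂.nonneg)
open Summit.QuantumFields.BalabanUV.Beta.GAN24.Push4 (vertexW vertexW_apply)
open Summit.QuantumFields.BalabanUV.Beta.GAN24.Push4Slices (push₃ push₃_inl_inl sliceSum tsum_zxu_eq_sliceSum)
open Summit.QuantumFields.BalabanUV.Beta.GAN24.BiStencilZeroMode (Tab)
open Summit.QuantumFields.BalabanUV.Beta.GAN24.LatticeFreeze (summable_mul_of_env abs_tsum_mul_le_of_env abs_tsum_mul_sub_frozen_le)

namespace Summit.QuantumFields.BalabanUV.Beta.GAN24.Push4FrozenLayers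


variable {d : ℕ}

/-! ## §0 Summation helpers -/

/-- [folklore] A function with an exponentially decaying bound about a centre is summable. -/
theorem summable_of_abs_le_exp {f : (Fin (d + 1) → ℤ) → ℝ} {B δ : ℝ} (hδ : 0 < δ) (u : Fin (d + 1) → ℤ)
    (h : ∀ v, |f v| ≤ B * Real.exp (-δ * l1 (v - u))) : Summable f :=
  Summable.of_norm_bounded ((summable_exp_shift' hδ u).mul_left B) (fun v => by rw [Real.norm_eq_abs]; exact h v)

/-- [folklore] … and its sum is at most `B·Zl δ`. -/
theorem abs_tsum_le_of_abs_le_exp {f : (Fin (d + 1) → ℤ) → ℝ} {B δ : ℝ} (hδ : 0 < δ) (u : Fin (d + 1) → ℤ)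
    (h : ∀ v, |f v| ≤ B * Real.exp (-δ * l1 (v - u))) : |∑' v, f v| ≤ B * Zl (d + 1) δ := by
  have hs := (summable_exp_shift' hδ u).mul_left B
  have hb := tsum_of_norm_bounded hs.hasSum (f := f) (fun v => by rw [Real.norm_eq_abs]; exact h v)
  rw [Real.norm_eq_abs] at hb
  refine hb.trans (le_of_eq ?_)
  rw [tsum_mul_left, tsum_exp_shift']

/-- [folklore] Three-step telescoping of absolute differences. -/
theorem abs_sub_le_of_three {P T₁ T₂ T₃ a b c : ℝ} (h₁ : |P - T₁| ≤ a) (h₂ : |T₁ - T₂| ≤ b) (h₃ : |T₂ - T₃| ≤ c) :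
    |P - T₃| ≤ a + b + c := by
  have e : P - T₃ = (P - T₁) + (T₁ - T₂) + (T₂ - T₃) := by ring
  rw [e]
  have h4 := abs_add_le ((P - T₁) + (T₁ - T₂)) (T₂ - T₃)
  have h5 := abs_add_le (P - T₁) (T₁ - T₂)
  linarith

/-- [folklore] A sup allowance at the base point: `|leg u| ≤ p`. -/
theorem abs_base_le {g : (Fin (d + 1) → ℤ) → ℝ} {u : Fin (d + 1) → ℤ} {p κ₀ : ℝ}
    (h : ∀ v, |g v| ≤ p * Real.exp (κ₀ * l1 (v - u))) : |g u| ≤ p := by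
  have := h u
  rwa [sub_self, show l1 (0 : Fin (d + 1) → ℤ) = 0 by simp [l1], mul_zero, Real.exp_zero, mul_one] at this

section Slice

/-! Fixed data: the legs, the table, the slice `(κ, u)`, the output indices, the constants. -/
variable {l r : Fin (d + 1) → (Fin (d + 1) → ℤ) → Fin (d + 1) → (Fin (d + 1) → ℤ) → ℝ} {X : Tab d} {C δ κ₀ p₁ q₁ p₂ q₂ p₃ q₃ : ℝ}
  {κ : Fin (d + 1)} {u : Fin (d + 1) → ℤ} {ν : Fin (d + 1)} {y' : Fin (d + 1) → ℤ} {α : Fin (d + 1)} {x' : Fin (d + 1) → ℤ}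
  {β : Fin (d + 1)} {z' : Fin (d + 1) → ℤ}
  (hX : LocStencil₂ X C δ) (hδ : 0 < δ) (hκ0 : 0 ≤ κ₀) (hκδ : κ₀ < δ)
  (hp₁ : 0 ≤ p₁) (hq₁ : 0 ≤ q₁) (hp₂ : 0 ≤ p₂) (hq₂ : 0 ≤ q₂) (hp₃ : 0 ≤ p₃) (hq₃ : 0 ≤ q₃)
  (hr₁ : ∀ κ' v, |r ν y' κ' v| ≤ p₁ * Real.exp (κ₀ * l1 (v - u)))
  (hr₁' : ∀ κ' v, |r ν y' κ' v - r ν y' κ' u| ≤ q₁ * l1 (v - u) * Real.exp (κ₀ * l1 (v - u)))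
  (hl₁ : ∀ κ₁ x, |l α x' κ₁ x| ≤ p₂ * Real.exp (κ₀ * l1 (x - u)))
  (hl₁' : ∀ κ₁ x, |l α x' κ₁ x - l α x' κ₁ u| ≤ q₂ * l1 (x - u) * Real.exp (κ₀ * l1 (x - u)))
  (hr₂ : ∀ κ₂ z, |r β z' κ₂ z| ≤ p₃ * Real.exp (κ₀ * l1 (z - u)))
  (hr₂' : ∀ κ₂ z, |r β z' κ₂ z - r β z' κ₂ u| ≤ q₃ * l1 (z - u) * Real.exp (κ₀ * l1 (z - u)))

/-! ## §1 The layers and their sizes -/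

section Layers
include hX

/-- [folklore] The slice entries: `|X κ u κ′ u′ x z (inl κ₁) (inl κ₂)| ≤ (C·e^{−δ(|x−u|₁+|z−u|₁)})·e^{−δ|u′−u|₁}`. -/
theorem abs_slice_le (κ' : Fin (d + 1)) (x z : Fin (d + 1) → ℤ) (κ₁ κ₂ : Fin (d + 1)) (u' : Fin (d + 1) → ℤ) :
    |X κ u κ' u' x z (Sum.inl κ₁) (Sum.inl κ₂)| ≤ (C * Real.exp (-δ * (l1 (x - u) + l1 (z - u)))) * Real.exp (-δ * l1 (u' - u)) := by
  refine (hX κ u κ' u' x z _ _).trans (le_of_eq ?_); ring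

include hδ in
/-- [folklore] The frozen innermost layer: `|Σ'_{u′} X…| ≤ C·Zl δ·e^{−δ(|x−u|₁+|z−u|₁)}` (and summability). -/
theorem abs_tsum_slice_le (κ' : Fin (d + 1)) (x z : Fin (d + 1) → ℤ) (κ₁ κ₂ : Fin (d + 1)) :
    (Summable fun u' : Fin (d + 1) → ℤ => X κ u κ' u' x z (Sum.inl κ₁) (Sum.inl κ₂)) ∧
      |∑' u' : Fin (d + 1) → ℤ, X κ u κ' u' x z (Sum.inl κ₁) (Sum.inl κ₂)| ≤ C * Zl (d + 1) δ * Real.exp (-δ * (l1 (x - u) + l1 (z - u))) :=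
  ⟨summable_of_abs_le_exp hδ u (abs_slice_le hX κ' x z κ₁ κ₂),
    (abs_tsum_le_of_abs_le_exp hδ u (abs_slice_le hX κ' x z κ₁ κ₂)).trans (le_of_eq (by ring))⟩

include hκδ hp₁ hr₁ in
/-- [folklore] The innermost layer with its leg: `|Σ'_{u′} r ν y′ κ′ u′ · X…| ≤ p₁·C·Zl₁·e^{−δ(|x−u|₁+|z−u|₁)}`, `Zl₁ := Zl(δ−κ₀)` (and summability). -/
theorem abs_inner_le (κ' : Fin (d + 1)) (x z : Fin (d + 1) → ℤ) (κ₁ κ₂ : Fin (d + 1)) :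
    (Summable fun u' : Fin (d + 1) → ℤ => r ν y' κ' u' * X κ u κ' u' x z (Sum.inl κ₁) (Sum.inl κ₂)) ∧
      |∑' u' : Fin (d + 1) → ℤ, r ν y' κ' u' * X κ u κ' u' x z (Sum.inl κ₁) (Sum.inl κ₂)|
        ≤ p₁ * (C * Real.exp (-δ * (l1 (x - u) + l1 (z - u)))) * Zl (d + 1) (δ - κ₀) := by
  have hw : ∀ v, |r ν y' κ' v| ≤ p₁ * Real.exp (κ₀ * l1 (v - u)) * 1 := fun v => by rw [mul_one]; exact hr₁ κ' v
  exact ⟨summable_mul_of_env hκδ hp₁ zero_le_one hw (abs_slice_le hX κ' x z κ₁ κ₂),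
    (abs_tsum_mul_le_of_env hκδ hp₁ zero_le_one hw (abs_slice_le hX κ' x z κ₁ κ₂)).trans (le_of_eq (by ring))⟩

include hκδ hp₁ hr₁ in
/-- [folklore] **THE INNER VERTEX LAYER** `W x z κ₁ κ₂ := vertexW r (X κ u) ν y′ x z (inl κ₁) (inl κ₂)`:
`|W| ≤ ((d+1)·p₁·C·Zl₁·e^{−δ|z−u|₁})·e^{−δ|x−u|₁}`. -/
theorem abs_W_le (x z : Fin (d + 1) → ℤ) (κ₁ κ₂ : Fin (d + 1)) :
    |vertexW r (X κ u) ν y' x z (Sum.inl κ₁) (Sum.inl κ₂)|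
      ≤ ((d + 1 : ℕ) * p₁ * C * Zl (d + 1) (δ - κ₀) * Real.exp (-δ * l1 (z - u))) * Real.exp (-δ * l1 (x - u)) := by
  rw [vertexW_apply]
  calc |∑ κ', ∑' u', r ν y' κ' u' * X κ u κ' u' x z (Sum.inl κ₁) (Sum.inl κ₂)|
      ≤ ∑ κ', |∑' u', r ν y' κ' u' * X κ u κ' u' x z (Sum.inl κ₁) (Sum.inl κ₂)| := Finset.abs_sum_le_sum_abs _ _
    _ ≤ ∑ _κ' : Fin (d + 1), p₁ * (C * Real.exp (-δ * (l1 (x - u) + l1 (z - u)))) * Zl (d + 1) (δ - κ₀) :=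
        Finset.sum_le_sum fun κ' _ => (abs_inner_le hX hκδ hp₁ hr₁ κ' x z κ₁ κ₂).2
    _ = _ := by
        rw [Finset.sum_const, Finset.card_univ, Fintype.card_fin, nsmul_eq_mul, mul_add, Real.exp_add]; ring

include hκδ hp₁ hp₂ hr₁ hl₁ in
/-- [folklore] The left-leg layer per `κ₁`: `|Σ'_x l α x′ κ₁ x · W x z κ₁ κ₂| ≤ p₂·((d+1)·p₁·C·Zl₁·e^{−δ|z−u|₁})·Zl₁` (and summability). -/
theorem abs_xlayer_le (z : Fin (d + 1) → ℤ) (κ₁ κ₂ : Fin (d + 1)) :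
    (Summable fun x : Fin (d + 1) → ℤ => l α x' κ₁ x * vertexW r (X κ u) ν y' x z (Sum.inl κ₁) (Sum.inl κ₂)) ∧
      |∑' x : Fin (d + 1) → ℤ, l α x' κ₁ x * vertexW r (X κ u) ν y' x z (Sum.inl κ₁) (Sum.inl κ₂)|
        ≤ p₂ * ((d + 1 : ℕ) * p₁ * C * Zl (d + 1) (δ - κ₀) * Real.exp (-δ * l1 (z - u))) * Zl (d + 1) (δ - κ₀) := by
  have hw : ∀ v, |l α x' κ₁ v| ≤ p₂ * Real.exp (κ₀ * l1 (v - u)) * 1 := fun v => by rw [mul_one]; exact hl₁ κ₁ v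
  have hφ : ∀ x, |vertexW r (X κ u) ν y' x z (Sum.inl κ₁) (Sum.inl κ₂)|
      ≤ ((d + 1 : ℕ) * p₁ * C * Zl (d + 1) (δ - κ₀) * Real.exp (-δ * l1 (z - u))) * Real.exp (-δ * l1 (x - u)) :=
    fun x => abs_W_le hX hκδ hp₁ hr₁ x z κ₁ κ₂
  exact ⟨summable_mul_of_env hκδ hp₂ zero_le_one hw hφ,
    (abs_tsum_mul_le_of_env hκδ hp₂ zero_le_one hw hφ).trans (le_of_eq (by ring))⟩

include hκδ hp₁ hp₂ hr₁ hl₁ in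
/-- [folklore] **THE LEFT-LEG LAYER** `G z κ₂ := Σ'_x Σ_{κ₁} l α x′ κ₁ x · W x z κ₁ κ₂`: summability of its summand, the finite-sum interchange, and
`|G z κ₂| ≤ ((d+1)²·p₁p₂·C·Zl₁²)·e^{−δ|z−u|₁}`. -/
theorem abs_G_le (z : Fin (d + 1) → ℤ) (κ₂ : Fin (d + 1)) :
    (Summable fun x : Fin (d + 1) → ℤ => ∑ κ₁, l α x' κ₁ x * vertexW r (X κ u) ν y' x z (Sum.inl κ₁) (Sum.inl κ₂)) ∧
    ((∑' x : Fin (d + 1) → ℤ, ∑ κ₁, l α x' κ₁ x * vertexW r (X κ u) ν y' x z (Sum.inl κ₁) (Sum.inl κ₂))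
        = ∑ κ₁, ∑' x : Fin (d + 1) → ℤ, l α x' κ₁ x * vertexW r (X κ u) ν y' x z (Sum.inl κ₁) (Sum.inl κ₂)) ∧
      |∑' x : Fin (d + 1) → ℤ, ∑ κ₁, l α x' κ₁ x * vertexW r (X κ u) ν y' x z (Sum.inl κ₁) (Sum.inl κ₂)|
        ≤ ((d + 1 : ℕ) * ((d + 1 : ℕ) * p₁ * C * Zl (d + 1) (δ - κ₀)) * p₂ * Zl (d + 1) (δ - κ₀)) * Real.exp (-δ * l1 (z - u)) := by
  have hs : ∀ κ₁ ∈ (Finset.univ : Finset (Fin (d + 1))),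
      Summable fun x : Fin (d + 1) → ℤ => l α x' κ₁ x * vertexW r (X κ u) ν y' x z (Sum.inl κ₁) (Sum.inl κ₂) :=
    fun κ₁ _ => (abs_xlayer_le hX hκδ hp₁ hp₂ hr₁ hl₁ z κ₁ κ₂).1
  have hswap := Summable.tsum_finsetSum hs
  refine ⟨summable_sum hs, hswap, ?_⟩
  rw [hswap]
  calc |∑ κ₁, ∑' x, l α x' κ₁ x * vertexW r (X κ u) ν y' x z (Sum.inl κ₁) (Sum.inl κ₂)|
      ≤ ∑ κ₁, |∑' x, l α x' κ₁ x * vertexW r (X κ u) ν y' x z (Sum.inl κ₁) (Sum.inl κ₂)| := Finset.abs_sum_le_sum_abs _ _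
    _ ≤ ∑ _κ₁ : Fin (d + 1), p₂ * ((d + 1 : ℕ) * p₁ * C * Zl (d + 1) (δ - κ₀) * Real.exp (-δ * l1 (z - u))) * Zl (d + 1) (δ - κ₀) :=
        Finset.sum_le_sum fun κ₁ _ => (abs_xlayer_le hX hκδ hp₁ hp₂ hr₁ hl₁ z κ₁ κ₂).2
    _ = _ := by rw [Finset.sum_const, Finset.card_univ, Fintype.card_fin, nsmul_eq_mul]; ring

end Layers

/-! ## §2 The three freezing steps -/

section Steps

include hX hκ0 hκδ hp₁ hp₂ hp₃ hq₃ hr₁ hl₁ hr₂ hr₂' in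
/-- [folklore] **STEP C — FREEZE THE RIGHT KERNEL LEG** (outermost layer `z`):
`|push₃ − Σ_{κ₂} r β z′ κ₂ u · Σ'_z G z κ₂| ≤ (d+1)·q₃·((d+1)²·p₁p₂·C·Zl₁²)·M₁`. -/
theorem stepC :
    |push₃ l r (X κ u) ν y' x' z' (Sum.inl α) (Sum.inl β)
        - ∑ κ₂, r β z' κ₂ u * ∑' z : Fin (d + 1) → ℤ, ∑' x : Fin (d + 1) → ℤ, ∑ κ₁,
            l α x' κ₁ x * vertexW r (X κ u) ν y' x z (Sum.inl κ₁) (Sum.inl κ₂)|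
      ≤ (d + 1 : ℕ) * (q₃ * 1 * ((d + 1 : ℕ) * ((d + 1 : ℕ) * p₁ * C * Zl (d + 1) (δ - κ₀)) * p₂ * Zl (d + 1) (δ - κ₀))
          * (2 / (δ - κ₀) * Zl (d + 1) ((δ - κ₀) / 2))) := by
  -- notation: `G z κ₂`
  set G : (Fin (d + 1) → ℤ) → Fin (d + 1) → ℝ := fun z κ₂ =>
    ∑' x : Fin (d + 1) → ℤ, ∑ κ₁, l α x' κ₁ x * vertexW r (X κ u) ν y' x z (Sum.inl κ₁) (Sum.inl κ₂) with hG
  have hGb : ∀ κ₂ z, |G z κ₂| ≤ ((d + 1 : ℕ) * ((d + 1 : ℕ) * p₁ * C * Zl (d + 1) (δ - κ₀)) * p₂ * Zl (d + 1) (δ - κ₀)) *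
      Real.exp (-δ * l1 (z - u)) := fun κ₂ z => (abs_G_le hX hκδ hp₁ hp₂ hr₁ hl₁ z κ₂).2.2
  have hw : ∀ κ₂ v, |r β z' κ₂ v| ≤ p₃ * Real.exp (κ₀ * l1 (v - u)) * 1 := fun κ₂ v => by rw [mul_one]; exact hr₂ κ₂ v
  have hw' : ∀ κ₂ v, |r β z' κ₂ v - r β z' κ₂ u| ≤ q₃ * l1 (v - u) * Real.exp (κ₀ * l1 (v - u)) * 1 := fun κ₂ v => by
    rw [mul_one]; exact hr₂' κ₂ v
  have hsum : ∀ κ₂, Summable fun z => r β z' κ₂ z * G z κ₂ := fun κ₂ =>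
    summable_mul_of_env hκδ hp₃ zero_le_one (hw κ₂) (hGb κ₂)
  have hrem : ∀ κ₂, |∑' z, r β z' κ₂ z * G z κ₂ - r β z' κ₂ u * ∑' z, G z κ₂|
      ≤ q₃ * 1 * ((d + 1 : ℕ) * ((d + 1 : ℕ) * p₁ * C * Zl (d + 1) (δ - κ₀)) * p₂ * Zl (d + 1) (δ - κ₀))
          * (2 / (δ - κ₀) * Zl (d + 1) ((δ - κ₀) / 2)) := fun κ₂ =>
    abs_tsum_mul_sub_frozen_le hκδ hκ0 hq₃ zero_le_one (hw' κ₂) (hGb κ₂) (hsum κ₂)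
  -- the entry, with the `κ₂`-sum outside
  have hentry : push₃ l r (X κ u) ν y' x' z' (Sum.inl α) (Sum.inl β) = ∑ κ₂, ∑' z, r β z' κ₂ z * G z κ₂ := by
    rw [push₃_inl_inl]
    have hs : ∀ κ₂ ∈ (Finset.univ : Finset (Fin (d + 1))), Summable fun z => G z κ₂ * r β z' κ₂ z :=
      fun κ₂ _ => (hsum κ₂).congr fun z => mul_comm _ _
    rw [Summable.tsum_finsetSum hs]
    exact Finset.sum_congr rfl fun κ₂ _ => tsum_congr fun z => mul_comm _ _
  rw [hentry, ← Finset.sum_sub_distrib]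
  calc |∑ κ₂, (∑' z, r β z' κ₂ z * G z κ₂ - r β z' κ₂ u * ∑' z, G z κ₂)|
      ≤ ∑ κ₂, |∑' z, r β z' κ₂ z * G z κ₂ - r β z' κ₂ u * ∑' z, G z κ₂| := Finset.abs_sum_le_sum_abs _ _
    _ ≤ ∑ _κ₂ : Fin (d + 1), q₃ * 1 * ((d + 1 : ℕ) * ((d + 1 : ℕ) * p₁ * C * Zl (d + 1) (δ - κ₀)) * p₂ * Zl (d + 1) (δ - κ₀))
          * (2 / (δ - κ₀) * Zl (d + 1) ((δ - κ₀) / 2)) := Finset.sum_le_sum fun κ₂ _ => hrem κ₂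
    _ = _ := by rw [Finset.sum_const, Finset.card_univ, Fintype.card_fin, nsmul_eq_mul]

end Steps

end Slice

end Summit.QuantumFields.BalabanUV.Beta.GAN24.Push4FrozenLayers

end
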